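import Summits.ABC.StewartYu.ArchG3StepPacks
import Summits.ABC.StewartYu.ArchG3Supply
import HarnessLib

/-!
# Cell abc-stewartyu, rung A1.L (crux r2 `ArchCoreRat`), WP-L.A: the archimedean k-step record packages FROM ONE INEQUALITY — closed forms
# for the box currencies `Γ`, `DΔ`, the Hasse-weight sizes `Wd`/`Wn` and the clearing denominators `den₀`

`Summits/ABC/StewartYu/ArchG3PackClosed.lean` — sequel to lp-1's `ArchG3StepPacks` (`ArchKStepHypU`, `ArchKStepOddHypU`) and p5's F6
`ArchG3Supply` (cell `abc-stewartyu`, HOME `run/shared/lean/pub/abc-stewartyu/`; TRANCHE PLAN v1.2 §4′ P-A5/P-A8 interface; seat p5 g8,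
plan RULING R30(d), «MINE» HOME/STATUS 17:1xZ).  Definitions (`GammaC`, `YC`, `DΔC`, `ArchSupply.WC`) and theorems; no named fact, no record.
Archimedean twin of p2's `PadicG3PackClosed` (`kstepHypU_of_ineq`): for the level polynomials `Rᵢ = Δ(·; i.1, H) ∘ 2^{ex}·` on unknowns
`U` with `i.1 ≤ L₀`, every datum of the k-step package is a CLOSED FORM of the level data `(H, ex, L₀)`, the box `L`, the Δ-basis `(c, e)`
and the radii — so the record (`ArchG3Par*`, seat p1) owes exactly ONE numerical inequality per node `x₁` and multi-index `(a, μ)`: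

* `GammaC L k = Lₖ + |bₖ/b_{j₀}|·L_{j₀} ≥ |𝔛ₖ(w)/b_{j₀}|` on the box (`ArchG3Setup.abs_zγ_le_of_box`, print (4.22));
* `YC c e L = Σₖ |c|·(|b_{j₀}|Lₖ + |bₖ|L_{j₀} + |eₖ|) ≥ Σₖ |yₖ(w)|` (`abs_yΔ_le_of_box`, (3.36)) and the NORMALISED Δ-weight size
  `DΔC Y T′ = (e·(1 + Y/T′))^{T′} ≥ (Y + |μ|)^{|μ|}/|μ|! ≥ |∏ₖ multichoose(yₖ(w), μₖ)|` for `|μ| < T′` (`abs_prod_dirDelta_eval_le` (3.37) +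
  `m^m/m! ≤ e^m`; `log DΔC = T′·(1 + log(1 + Y/T′))` — print's «log(eB) + O(1) per derivative», NO `T′·log T′`, loss-ledger rule R26(d));
* `ArchSupply.WC H ex L₀ Nord ρ = 2^{ex·Nord}·e^{H/e}·(e(1 + 2^{ex}ρ/H))^{L₀}` ≥ the Hasse weights of orders `≤ Nord` on `‖z‖ ≤ ρ` (F6
  `norm_hw_scaledFeldR_le_of_le`, Lemma 3.10 (3.35)) and at the integers `|x| ≤ ρ` (`abs_hasse_scaledFeldR_eval_le_of_le`);
* `den₀ a x = ν(H)^a`: `ν(H)^a · (Hasse_a (Δ∘2^{ex}·))(x) = 2^{ex·a}·zeroWeight ∈ ℤ` (`ArchSupply.lcm_pow_mul_hasse_scaledFeldR_eq`, Prop. 3.1 (1));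
* **`archKStepHypU_of_ineq`** / **`archKStepOddHypU_of_ineq`** — `ArchKStepHypU (fun i => Δ(·;i.1,H)∘2^{ex}·) U L P w γb c e δ₀ N N′ T T′`
  (resp. the odd-node package) from the schedule data, `|log αₖ| ≤ Aₖ`, `E ≥ 1`, `C ≥ 1`, `w ≥ 0`, `L_{j₀}δ₀·(radius) ≤ 1`, `H ≥ 1`, and ONE
  inequality per `(x₁, a, μ)` — lp-1's `hfinal` with the closed forms substituted and right-hand side `1/(ν(H)^a · monDen(α, L|x₁|))`.

WHAT THIS IS NOT: the inequality (record, P-A8); the half-step package (`ArchG3PackClosedHalf`, after lp-1's `ArchG3Schedule`); no crux moves.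

## References
* Yu. V. Nesterenko, *Linear forms in logarithms of rational numbers*, LNM 1819 (2003) — §3.1 Prop. 3.1, §3.5 (3.35)–(3.37) p. 73–75,
  §4.2 (4.22), (4.24)–(4.35) p. 85–90. [Nesterenko2003]
* K. Yu, Acta Math. 211 (2013) — §5 (the `p`-adic model; cell file `PadicG3PackClosed`). [Yu2013]
-/

noncomputable section

open Finset Polynomial
open Literature.NumberTheory.Transcendental
open Literature.NumberTheory.Transcendental.CW77.Setup (Tau tauNorm)
open Summit.ABC.StewartYu.DirWeights (dirDelta prod_dirDelta_eval_intCast abs_prod_dirDelta_eval_le)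
open scoped Nat

namespace Summit.ABC.StewartYu

/-! ### The Hasse-weight sizes of the level polynomials (closed form) -/

namespace ArchSupply

open Summit.ABC.StewartYu.FeldmanBasis (feldR lcm_pow_mul_hasse_feldR_eq_zeroWeight)

/-- **The uniform Hasse-weight size** `WC H ex L₀ Nord ρ = 2^{ex·Nord} · e^{H/e} · (e(1 + 2^{ex}ρ/H))^{L₀}` of the level polynomials
`Δ(·; ℓ, H) ∘ 2^{ex}·`, `ℓ ≤ L₀`, orders `≤ Nord`, on `‖z‖ ≤ ρ` (serves `Wd`, `Wn` and the half-point `Wh`). [cite: Nesterenko2003, §3.5 Lemma 3.10 (3.35), p. 73] -/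
def WC (H ex L₀ Nord : ℕ) (ρ : ℝ) : ℝ :=
  (2 : ℝ) ^ (ex * Nord) * (Real.exp (H / Real.exp 1) * (Real.exp 1 * (1 + (2 : ℝ) ^ ex * ρ / H)) ^ L₀)

/-- `0 ≤ WC` for `ρ ≥ 0`. [folklore] -/
theorem WC_nonneg (H ex L₀ Nord : ℕ) {ρ : ℝ} (hρ : 0 ≤ ρ) : 0 ≤ WC H ex L₀ Nord ρ := by
  unfold WC; positivity

/-- **`Wd`/`Wh`**: on the disc `‖z‖ ≤ ρ`, `‖(hw R i a)(z)‖ ≤ WC H ex L₀ Nord ρ` for `Rᵢ = Δ(·; i.1, H) ∘ 2^{ex}·`, `i.1 ≤ L₀`, `a ≤ Nord`.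
[cite: Nesterenko2003, §3.5 Lemma 3.10 (3.35), p. 73] -/
theorem norm_hw_le_WC {K : Type*} {H : ℕ} (hH : 1 ≤ H) (ex : ℕ) {L₀ Nord : ℕ} (i : ℕ × K) (hi : i.1 ≤ L₀) {a : ℕ} (ha : a ≤ Nord)
    {z : ℂ} {ρ : ℝ} (hz : ‖z‖ ≤ ρ) :
    ‖(ArchG3Setup.hw (fun i : ℕ × K => scaledFeldR i.1 H ex) i a).eval z‖ ≤ WC H ex L₀ Nord ρ :=
  norm_hw_scaledFeldR_le_of_le (fun i : ℕ × K => i.1) hH ex i hi ha hz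

/-- **`Wn`**: at the integers `|x| ≤ Xb`, `|(Hasse_{t₀} Rᵢ)(x)| ≤ WC H ex L₀ Nord Xb` for `i.1 ≤ L₀`, `t₀ ≤ Nord`.
[cite: Nesterenko2003, §3.5 Lemma 3.10 (3.35), p. 73] -/
theorem abs_hasse_le_WC {K : Type*} {H : ℕ} (hH : 1 ≤ H) (ex : ℕ) {L₀ Nord : ℕ} (i : ℕ × K) (hi : i.1 ≤ L₀) {t₀ : ℕ}
    (ht₀ : t₀ ≤ Nord) {x : ℤ} {Xb : ℝ} (hx : |(x : ℝ)| ≤ Xb) :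
    |(((hasseDeriv t₀ (scaledFeldR i.1 H ex)).eval (x : ℚ) : ℚ) : ℝ)| ≤ WC H ex L₀ Nord Xb :=
  abs_hasse_scaledFeldR_eval_le_of_le (fun i : ℕ × K => i.1) hH ex i hi ht₀ hx

/-- **`den₀ = ν(H)^a`, EXACT**: `ν(H)^a · (Hasse_a (Δ(·;ℓ,H) ∘ 2^{ex}·))(x) = 2^{ex·a} · zeroWeight ℓ H a (2^{ex} x)` (an integer).
[cite: Nesterenko2003, §3.1 Prop. 3.1 (1), §3.5 (p. 72)] -/
theorem lcm_pow_mul_hasse_scaledFeldR_eq (ℓ : ℕ) {H : ℕ} (hH : 1 ≤ H) (ex a : ℕ) (x : ℤ) :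
    (((Nat.lcmUpto H) ^ a : ℕ) : ℚ) * (hasseDeriv a (scaledFeldR ℓ H ex)).eval (x : ℚ) =
      (((2 : ℤ) ^ (ex * a) * DirWeights.zeroWeight ℓ H a (2 ^ ex * x) : ℤ) : ℚ) := by
  rw [hasse_scaledFeldR_eval]
  have h := lcm_pow_mul_hasse_feldR_eq_zeroWeight ℓ hH a (2 ^ ex * x)
  push_cast at h ⊢
  rw [← pow_mul]
  calc ((Nat.lcmUpto H : ℚ)) ^ a * ((2 : ℚ) ^ (ex * a) * (hasseDeriv a (feldR ℓ H)).eval ((2 : ℚ) ^ ex * (x : ℚ)))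
      = (2 : ℚ) ^ (ex * a) * (((Nat.lcmUpto H : ℚ)) ^ a * (hasseDeriv a (feldR ℓ H)).eval ((2 : ℚ) ^ ex * (x : ℚ))) := by ring
    _ = (2 : ℚ) ^ (ex * a) * (DirWeights.zeroWeight ℓ H a (2 ^ ex * x) : ℚ) := by rw [h]

/-- `ν(H)^a · (Hasse_a (Δ ∘ 2^{ex}·))(x) ∈ ℤ` (pure integrality, no size datum). [cite: Nesterenko2003, §3.1 Prop. 3.1 (1)] -/
theorem exists_int_lcm_pow_mul_hasse_scaledFeldR_int (ℓ : ℕ) {H : ℕ} (hH : 1 ≤ H) (ex a : ℕ) (x : ℤ) :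
    ∃ z₀ : ℤ, (((Nat.lcmUpto H) ^ a : ℕ) : ℚ) * (hasseDeriv a (scaledFeldR ℓ H ex)).eval (x : ℚ) = z₀ :=
  ⟨_, lcm_pow_mul_hasse_scaledFeldR_eq ℓ hH ex a x⟩

end ArchSupply

namespace ArchG3Setup

variable (S : ArchG3Setup) {K : Type*}

/-! ### The box currencies `Γ`, `Y`, `DΔ` (closed forms) -/

/-- `GammaC L k = Lₖ + |bₖ/b_{j₀}|·L_{j₀}` — the box bound of the `b`-eliminated directional coefficient `𝔛ₖ(w)/b_{j₀}`.
[cite: Nesterenko2003, §4.2 (4.22), p. 86] -/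
def GammaC (L : Fin S.n → ℕ) (k : Fin S.n) : ℝ := (L k : ℝ) + |(S.b k : ℝ) / (S.b S.j₀ : ℝ)| * (L S.j₀ : ℝ)

/-- `0 ≤ GammaC`. [folklore] -/
theorem GammaC_nonneg (L : Fin S.n → ℕ) (k : Fin S.n) : 0 ≤ S.GammaC L k := by unfold GammaC; positivity

/-- `|zγ(w)ₖ| ≤ GammaC L k` on the box `|wⱼ| ≤ Lⱼ`. [cite: Nesterenko2003, §4.2 (4.22), p. 86] -/
theorem abs_zγ_le_GammaC {L : Fin S.n → ℕ} {w : Fin S.n → ℤ} (hw : ∀ j, |w j| ≤ (L j : ℤ)) (k : Fin S.n) :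
    |(S.zγ w k : ℝ)| ≤ S.GammaC L k :=
  S.abs_zγ_le_of_box hw k

/-- `YC c e L = Σₖ |c|·(|b_{j₀}|·Lₖ + |bₖ|·L_{j₀} + |eₖ|)` — the box bound of `Σₖ |yₖ(w)|`, `yₖ(w) = c(𝔛ₖ(w) − eₖ)`.
[cite: Nesterenko2003, §3.5 (3.36), p. 74] -/
def YC (c : ℤ) (e : Fin S.n → ℤ) (L : Fin S.n → ℕ) : ℝ :=
  ∑ k, |(c : ℝ)| * (|(S.b S.j₀ : ℝ)| * (L k : ℝ) + |(S.b k : ℝ)| * (L S.j₀ : ℝ) + |(e k : ℝ)|)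

/-- `0 ≤ YC`. [folklore] -/
theorem YC_nonneg (c : ℤ) (e : Fin S.n → ℤ) (L : Fin S.n → ℕ) : 0 ≤ S.YC c e L :=
  sum_nonneg fun k _ => by positivity

/-- `Σₖ |yₖ(w)| ≤ YC c e L` on the box. [cite: Nesterenko2003, §3.5 (3.36), p. 74] -/
theorem sum_abs_yΔ_le_YC (c : ℤ) (e : Fin S.n → ℤ) {L : Fin S.n → ℕ} {w : Fin S.n → ℤ} (hw : ∀ j, |w j| ≤ (L j : ℤ)) :
    ∑ k, |(S.yΔ c e w k : ℝ)| ≤ S.YC c e L :=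
  sum_le_sum fun k _ => S.abs_yΔ_le_of_box c e hw k

/-- **The normalised Δ-weight size** `DΔC Y T′ = (e·(1 + Y/T′))^{T′}`. [cite: Nesterenko2003, §3.5 (3.37), p. 75; shape only] -/
def DΔC (Y : ℝ) (T' : ℕ) : ℝ := (Real.exp 1 * (1 + Y / T')) ^ T'

/-- `0 ≤ DΔC` for `Y ≥ 0`. [folklore] -/
theorem DΔC_nonneg {Y : ℝ} (hY : 0 ≤ Y) (T' : ℕ) : 0 ≤ DΔC Y T' := by unfold DΔC; positivity

/-- **`(Y + m)^m / m! ≤ (e·(1 + Y/T′))^{T′}` for `m ≤ T′`, `1 ≤ T′`, `Y ≥ 0`** — via `(Y+m)^m ≤ (Y+T′)^m ≤ (Y+T′)^{T′}/T′^{T′−m}` and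
`T′^m/m! ≤ e^{T′}`. [folklore] -/
theorem pow_div_factorial_le_DΔC {Y : ℝ} (hY : 0 ≤ Y) {m T' : ℕ} (hm : m ≤ T') (hT : 1 ≤ T') :
    (Y + m) ^ m / (m ! : ℝ) ≤ DΔC Y T' := by
  have hT0 : (0 : ℝ) < T' := by exact_mod_cast hT
  have hT1 : (1 : ℝ) ≤ T' := by exact_mod_cast hT
  have hmT : (m : ℝ) ≤ T' := by exact_mod_cast hm
  have hfac : (0 : ℝ) < (m ! : ℝ) := by exact_mod_cast Nat.factorial_pos m
  -- (Y+m)^m ≤ (Y+T')^m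
  have h1 : (Y + m) ^ m ≤ (Y + T') ^ m := pow_le_pow_left₀ (by positivity) (by linarith) m
  -- (Y+T')^m * T'^(T'-m) ≤ (Y+T')^T'
  have h2 : (Y + T') ^ m * (T' : ℝ) ^ (T' - m) ≤ (Y + T') ^ T' := by
    have e1 : (Y + T') ^ T' = (Y + T') ^ m * (Y + T') ^ (T' - m) := by rw [← pow_add, Nat.add_sub_cancel' hm]
    rw [e1]
    exact mul_le_mul_of_nonneg_left (pow_le_pow_left₀ hT0.le (by linarith) _) (by positivity)
  -- T'^m / m! ≤ e^{T'}
  have h3 : (T' : ℝ) ^ m / (m ! : ℝ) ≤ Real.exp T' := Real.pow_div_factorial_le_exp (T' : ℝ) hT0.le m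
  -- T'^T' = T'^m * T'^(T'-m)
  have e2 : (T' : ℝ) ^ T' = (T' : ℝ) ^ m * (T' : ℝ) ^ (T' - m) := by rw [← pow_add, Nat.add_sub_cancel' hm]
  have hTm : (0 : ℝ) < (T' : ℝ) ^ (T' - m) := pow_pos hT0 _
  have hTT : (0 : ℝ) < (T' : ℝ) ^ T' := pow_pos hT0 _
  -- the closed form
  have hD : DΔC Y T' = Real.exp T' * (Y + T') ^ T' / (T' : ℝ) ^ T' := by
    unfold DΔC
    rw [mul_pow, ← Real.exp_one_pow T', show (1 + Y / T' : ℝ) = (Y + T') / T' by field_simp; ring, div_pow]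
    ring
  rw [hD]
  calc (Y + m) ^ m / (m ! : ℝ) ≤ (Y + T') ^ m / (m ! : ℝ) := div_le_div_of_nonneg_right h1 hfac.le
    _ ≤ ((Y + T') ^ T' / (T' : ℝ) ^ (T' - m)) / (m ! : ℝ) :=
        div_le_div_of_nonneg_right ((le_div_iff₀ hTm).mpr h2) hfac.le
    _ = (Y + T') ^ T' / (T' : ℝ) ^ T' * ((T' : ℝ) ^ m / (m ! : ℝ)) := by
        rw [e2]; field_simp
    _ ≤ (Y + T') ^ T' / (T' : ℝ) ^ T' * Real.exp T' :=
        mul_le_mul_of_nonneg_left h3 (by positivity)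
    _ = Real.exp T' * (Y + T') ^ T' / (T' : ℝ) ^ T' := by ring

/-- **The Δ-weights on the box**: `|∏ₖ multichoose(yₖ(w), μₖ)| ≤ DΔC (YC c e L) T′` for `|wⱼ| ≤ Lⱼ` and `a + |μ| < T′` — the `DΔ` datum
of `ArchKStepHypU` in closed form. [cite: Nesterenko2003, §3.5 (3.37), p. 75] -/
theorem abs_prod_multichoose_le_DΔC (c : ℤ) (e : Fin S.n → ℤ) {L : Fin S.n → ℕ} {w : Fin S.n → ℤ} (hw : ∀ j, |w j| ≤ (L j : ℤ))
    {T' a : ℕ} {μ : Fin S.n → ℕ} (haμ : a + ∑ k, μ k < T') :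
    |((∏ k, Ring.multichoose (S.yΔ c e w k) (μ k) : ℤ) : ℝ)| ≤ DΔC (S.YC c e L) T' := by
  have hcast : ((∏ k, Ring.multichoose (S.yΔ c e w k) (μ k) : ℤ) : ℝ) = ∏ k, (dirDelta ℝ (μ k)).eval ((S.yΔ c e w k : ℤ) : ℝ) :=
    (prod_dirDelta_eval_intCast (K := ℝ) univ μ (fun k => S.yΔ c e w k)).symm
  rw [hcast]
  refine (abs_prod_dirDelta_eval_le (K := ℝ) univ μ (fun k => ((S.yΔ c e w k : ℤ) : ℝ))).trans ?_
  set m : ℕ := ∑ k, μ k with hm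
  have hY := S.sum_abs_yΔ_le_YC c e hw
  have hY0 : 0 ≤ S.YC c e L := S.YC_nonneg c e L
  have hfac : (0 : ℝ) < (m ! : ℝ) := by exact_mod_cast Nat.factorial_pos m
  calc (∑ k, |((S.yΔ c e w k : ℤ) : ℝ)| + (m : ℕ)) ^ m / (m ! : ℝ) ≤ (S.YC c e L + m) ^ m / (m ! : ℝ) := by
        refine div_le_div_of_nonneg_right (pow_le_pow_left₀ (by positivity) (by simpa using hY) m) hfac.le
    _ ≤ DΔC (S.YC c e L) T' := pow_div_factorial_le_DΔC hY0 (by omega) (by omega)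

/-! ### The k-step packages from one inequality -/

/-- **`ArchKStepHypU` from one inequality** (symmetric nodes `|x| ≤ N → |x| ≤ N′ ≤ 3N+2`): for the level polynomials
`Rᵢ = Δ(·; i.1, H) ∘ 2^{ex}·` on unknowns `U` with `i.1 ≤ L₀`, the package holds with `Γ := GammaC L`, `DΔ := DΔC (YC c e L) T′`,
`Wd := WC H ex L₀ T′ ((3E+1)(2N+1)+N)`, `Wn := WC H ex L₀ T (3N+2)`, `den₀ a x := ν(H)^a`, given the schedule data and ONE inequality per
`(x₁, a, μ)`. [cite: Nesterenko2003, §4.2 (4.24)–(4.35), p. 87–90; shape only] -/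
theorem archKStepHypU_of_ineq {H : ℕ} (hH : 1 ≤ H) (ex L₀ : ℕ) (U : Finset (ℕ × K)) (hU : ∀ i ∈ U, i.1 ≤ L₀)
    (L : Fin S.n → ℕ) (P : ℤ) {w : ℝ} (hw : 0 ≤ w) (γb : ℝ) (c : ℤ) (e : Fin S.n → ℤ) {δ₀ : ℝ} {N N' T T' t : ℕ}
    (ht : 1 ≤ t) (hT : T' + t ≤ T) (hN' : N' ≤ 3 * N + 2) {A : Fin S.n → ℝ} (hA : ∀ k, |S.lg k| ≤ A k)
    {E : ℝ} (hE : 1 ≤ E) (hsmall : (L S.j₀ : ℝ) * δ₀ * (3 * N + 2) ≤ 1) {C : ℝ} (hC : 1 ≤ C)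
    (hineq : ∀ x₁ : ℤ, |x₁| ≤ (N' : ℤ) → ∀ (a : ℕ) (μ : Fin S.n → ℕ), a + ∑ k, μ k < T' →
      Real.exp (γb * N') *
        (2 * ((2 * N + 1 : ℕ) : ℝ) ^ (t + 1) * t * (20 * Real.exp 1) ^ ((2 * N + 1) * t) *
            ((2 * C) ^ t * Real.exp (γb * (N + 1)) *
              ((2 : ℝ) ^ a * Real.exp ((∑ k, A k * S.GammaC L k) / C) *
                (U.card * (P * DΔC (S.YC c e L) T') * ArchSupply.WC H ex L₀ T (3 * N + 2) * Real.exp ((γb + w) * N) *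
                  (2 * ((L S.j₀ : ℝ) * δ₀ * N))))) +
          U.card * (P * DΔC (S.YC c e L) T') * ArchSupply.WC H ex L₀ T' ((3 * E + 1) * (2 * N + 1) + N) *
            Real.exp ((w + (L S.j₀ : ℝ) * δ₀) * ((3 * E + 1) * (2 * N + 1) + N)) * (1 / E) ^ ((2 * N + 1) * t)) +
        U.card * (P * DΔC (S.YC c e L) T') * ArchSupply.WC H ex L₀ T (3 * N + 2) * Real.exp ((γb + w) * N') *
          (2 * ((L S.j₀ : ℝ) * δ₀ * N')) <
      1 / (((Nat.lcmUpto H) ^ a * MonomialDen.monDen S.α (fun j => L j * x₁.natAbs) : ℕ) : ℝ)) :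
    S.ArchKStepHypU (fun i : ℕ × K => ArchSupply.scaledFeldR i.1 H ex) U L P w γb c e δ₀ N N' T T' := by
  have hρd : (0 : ℝ) ≤ (3 * E + 1) * (2 * N + 1) + N := by
    have : (0 : ℝ) ≤ E := le_trans zero_le_one hE
    positivity
  have hρn : (0 : ℝ) ≤ 3 * N + 2 := by positivity
  refine ⟨t, A, S.GammaC L, DΔC (S.YC c e L) T', E, ArchSupply.WC H ex L₀ T' ((3 * E + 1) * (2 * N + 1) + N),
    ArchSupply.WC H ex L₀ T (3 * N + 2), C, fun a _ => (Nat.lcmUpto H) ^ a, ht, hT, hN', hA, S.GammaC_nonneg L,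
    fun w' hw' k => S.abs_zγ_le_GammaC hw' k, DΔC_nonneg (S.YC_nonneg c e L) T',
    fun w' hw' a μ haμ => S.abs_prod_multichoose_le_DΔC c e hw' haμ, hE, ?_, ArchSupply.WC_nonneg H ex L₀ T hρn, ?_, hw, hsmall, hC,
    fun a _ => Nat.one_le_pow _ _ (Nat.lcmUpto_pos H), ?_, hineq⟩
  · intro i hi a ha z hz
    exact ArchSupply.norm_hw_le_WC hH ex i (hU i hi) ha.le hz
  · intro i hi t₀ ht₀ x hx
    have hx' : |(x : ℝ)| ≤ 3 * N + 2 := by exact_mod_cast hx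
    exact ArchSupply.abs_hasse_le_WC hH ex i (hU i hi) ht₀.le hx'
  · intro a _ x _ i _
    exact ArchSupply.exists_int_lcm_pow_mul_hasse_scaledFeldR_int i.1 hH ex a x

/-- **`ArchKStepOddHypU` from one inequality** (first k-step of a level: odd nodes `|x| ≤ 2m − 1 → |x| ≤ N′ ≤ 6m`): the same closed forms
with the radii `(12E+6)m` (disc) and `6m` (integer nodes). [cite: Nesterenko2003, §4.2 with the nodes 𝒳_{s,0}, p. 87–90; shape only] -/
theorem archKStepOddHypU_of_ineq {H : ℕ} (hH : 1 ≤ H) (ex L₀ : ℕ) (U : Finset (ℕ × K)) (hU : ∀ i ∈ U, i.1 ≤ L₀)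
    (L : Fin S.n → ℕ) (P : ℤ) {w : ℝ} (hw : 0 ≤ w) (γb : ℝ) (c : ℤ) (e : Fin S.n → ℤ) {δ₀ : ℝ} {m N' T T' t : ℕ}
    (hm : 1 ≤ m) (ht : 1 ≤ t) (hT : T' + t ≤ T) (hN' : N' ≤ 6 * m) {A : Fin S.n → ℝ} (hA : ∀ k, |S.lg k| ≤ A k)
    {E : ℝ} (hE : 1 ≤ E) (hsmall : (L S.j₀ : ℝ) * δ₀ * (6 * m) ≤ 1) {C : ℝ} (hC : 1 ≤ C)
    (hineq : ∀ x₁ : ℤ, |x₁| ≤ (N' : ℤ) → ∀ (a : ℕ) (μ : Fin S.n → ℕ), a + ∑ k, μ k < T' →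
      Real.exp (γb * N') *
        (2 * ((2 * m : ℕ) : ℝ) ^ (t + 1) * t * (20 * Real.exp 1) ^ ((2 * m) * t) *
            (2 ^ t * ((2 * C) ^ t * Real.exp (γb * (2 * m)) *
              ((2 : ℝ) ^ a * Real.exp ((∑ k, A k * S.GammaC L k) / C) *
                (U.card * (P * DΔC (S.YC c e L) T') * ArchSupply.WC H ex L₀ T (6 * m) *
                  Real.exp ((γb + w) * ((2 * m - 1 : ℕ) : ℝ)) *
                  (2 * ((L S.j₀ : ℝ) * δ₀ * ((2 * m - 1 : ℕ) : ℝ))))))) +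
          U.card * (P * DΔC (S.YC c e L) T') * ArchSupply.WC H ex L₀ T' ((12 * E + 6) * m) *
            Real.exp ((w + (L S.j₀ : ℝ) * δ₀) * ((12 * E + 6) * m)) * (1 / E) ^ ((2 * m) * t)) +
        U.card * (P * DΔC (S.YC c e L) T') * ArchSupply.WC H ex L₀ T (6 * m) * Real.exp ((γb + w) * N') *
          (2 * ((L S.j₀ : ℝ) * δ₀ * N')) <
      1 / (((Nat.lcmUpto H) ^ a * MonomialDen.monDen S.α (fun j => L j * x₁.natAbs) : ℕ) : ℝ)) :
    S.ArchKStepOddHypU (fun i : ℕ × K => ArchSupply.scaledFeldR i.1 H ex) U L P w γb c e δ₀ m N' T T' := by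
  have hρd : (0 : ℝ) ≤ (12 * E + 6) * m := by
    have : (0 : ℝ) ≤ E := le_trans zero_le_one hE
    positivity
  have hρn : (0 : ℝ) ≤ 6 * m := by positivity
  refine ⟨t, A, S.GammaC L, DΔC (S.YC c e L) T', E, ArchSupply.WC H ex L₀ T' ((12 * E + 6) * m),
    ArchSupply.WC H ex L₀ T (6 * m), C, fun a _ => (Nat.lcmUpto H) ^ a, hm, ht, hT, hN', hA, S.GammaC_nonneg L,
    fun w' hw' k => S.abs_zγ_le_GammaC hw' k, DΔC_nonneg (S.YC_nonneg c e L) T',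
    fun w' hw' a μ haμ => S.abs_prod_multichoose_le_DΔC c e hw' haμ, hE, ?_, ArchSupply.WC_nonneg H ex L₀ T hρn, ?_, hw, hsmall, hC,
    fun a _ => Nat.one_le_pow _ _ (Nat.lcmUpto_pos H), ?_, hineq⟩
  · intro i hi a ha z hz
    exact ArchSupply.norm_hw_le_WC hH ex i (hU i hi) ha.le hz
  · intro i hi t₀ ht₀ x hx
    have hx' : |(x : ℝ)| ≤ 6 * m := by exact_mod_cast hx
    exact ArchSupply.abs_hasse_le_WC hH ex i (hU i hi) ht₀.le hx'
  · intro a _ x _ i _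
    exact ArchSupply.exists_int_lcm_pow_mul_hasse_scaledFeldR_int i.1 hH ex a x

end ArchG3Setup

end Summit.ABC.StewartYu

end
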